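import Mathlib
import Literature.Analysis.FluidPDE.NSWave0
import Summits.NavierStokesRegularity.NavierStokesRegularity.Theorems.PlaneEnergyCeilingSlabEnergyIdentitySlab
import Summits.NavierStokesRegularity.NavierStokesRegularity.Theorems.PlaneEnergyCeilingSlabEnergyIdentityPointwise

/-!
# Route PlaneEnergyCeiling · crux `PlanarEnergyAPriori` — stub `stub_initialPlanarCeiling`

Helper file for the crux item stmt-NavierStokesRegularity-16855 (`PlanarEnergyAPriori`, route
`PlaneEnergyCeiling`); it proves, with EXACTLY the registered signature, the stub
`stub_initialPlanarCeiling` of the line `Cruxes/PlanarEnergyAPriori/Lines/birth.lean`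
(RAPID DECAY ⇒ INITIAL PLANAR CEILING) and lands `--supports` that item.

**Statement.** A datum `u₀ : ℝ³ → ℝ³` with Fefferman decay (4) (`HasRapidSpatialDecay`) has planar
kinetic energy `∫_{ℝ²} |u₀(R(y₀,y₁,c))|² dy ≤ M₀` through every plane `R({x₂ = c})`, with one
constant `M₀ ≥ 0` for all linear isometries `R` and all offsets `c`.

**Proof.** `n = 0`, `K = 4` in `HasRapidSpatialDecay` gives `|u₀(x)| ≤ C (1 + |x|)⁻⁴`
(`norm_iteratedFDeriv_le_weight`); an isometry preserves `1 + ‖x‖` and `‖(y₀,y₁,c)‖ ≥ ‖y‖`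
(`norm_le_norm_toLp_vec3`), so on the plane `|u₀|² ≤ C² w(y)² ≤ C² w(y)` with the weight
`w(y) = (1 + |y|)⁻⁴ ≤ 1`, which is integrable on `ℝ²` (`integrable_one_add_norm`, `4 > 2`);
`M₀ := ∫ C² w` and `lintegral_mono` (no measurability needed). [Fefferman2000, (4)]
-/

noncomputable section

-- single-conjunct summit: `Summit.<Summit>.<Problem>` repeats the name by the D-0017 layout
set_option linter.dupNamespace false

namespace Summit.NavierStokesRegularity.NavierStokesRegularity.Theorems.PlanarEnergyAPriori

open MeasureTheory Set Filter Topology WithLp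
open scoped ENNReal
open Literature.Analysis.FluidPDE
open Summit.NavierStokesRegularity.NavierStokesRegularity.Theorems.PlaneEnergyCeilingSlabEnergyIdentity

/-- The weight `C² (1 + ‖y‖)⁻⁴` is integrable on `ℝ²` (`4 > 2 = dim ℝ²`). -/
theorem integrable_const_mul_weight_two (C : ℝ) :
    Integrable fun y : EuclideanSpace ℝ (Fin 2) => C * (1 + ‖y‖) ^ (-(4 : ℝ)) := by
  have hr : (Module.finrank ℝ (EuclideanSpace ℝ (Fin 2)) : ℝ) < 4 := by
    rw [finrank_euclideanSpace, Fintype.card_fin]; norm_num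
  exact (integrable_one_add_norm hr).const_mul C

/-- **Pointwise planar bound.** If `‖g x‖ ≤ C (1 + ‖x‖)⁻⁴` on `ℝ³`, then on every plane
`R({x₂ = c})` the squared norm is dominated by the integrable planar weight:
`‖g (R (y₀,y₁,c))‖ₑ² ≤ ofReal (C² (1 + ‖y‖)⁻⁴)`. -/
theorem enorm_sq_comp_isometry_le {F : Type*} [NormedAddCommGroup F] {g : EuclideanSpace ℝ (Fin 3) → F} {C : ℝ}
    (h : ∀ x, ‖g x‖ ≤ C * (1 + ‖x‖) ^ (-(4 : ℝ)))
    (R : EuclideanSpace ℝ (Fin 3) ≃ₗᵢ[ℝ] EuclideanSpace ℝ (Fin 3)) (c : ℝ) (y : EuclideanSpace ℝ (Fin 2)) :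
    ‖g (R (toLp 2 ![y 0, y 1, c]))‖ₑ ^ 2 ≤ ENNReal.ofReal (C ^ 2 * (1 + ‖y‖) ^ (-(4 : ℝ))) := by
  have hC : 0 ≤ C := nonneg_of_norm_le_weight h
  set w : ℝ := (1 + ‖y‖) ^ (-(4 : ℝ)) with hw
  have hw0 : 0 < w := weight_pos y
  have hw1 : w ≤ 1 := weight_le_one y
  -- the bound at the point of the plane, transported through the isometry and down to `y`
  have h1 : ‖g (R (toLp 2 ![y 0, y 1, c]))‖ ≤ C * w := by
    calc ‖g (R (toLp 2 ![y 0, y 1, c]))‖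
        ≤ C * (1 + ‖R (toLp 2 ![y 0, y 1, c])‖) ^ (-(4 : ℝ)) := h _
      _ = C * (1 + ‖(toLp 2 ![y 0, y 1, c] : EuclideanSpace ℝ (Fin 3))‖) ^ (-(4 : ℝ)) := by
          rw [LinearIsometryEquiv.norm_map]
      _ ≤ C * w := by
          gcongr C * ?_
          exact Real.rpow_le_rpow_of_nonpos (by positivity)
            (by linarith [norm_le_norm_toLp_vec3 y c]) (by norm_num)
  have h2 : ‖g (R (toLp 2 ![y 0, y 1, c]))‖ ^ 2 ≤ C ^ 2 * w := by
    calc ‖g (R (toLp 2 ![y 0, y 1, c]))‖ ^ 2 ≤ (C * w) ^ 2 := by gcongr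
      _ = C ^ 2 * w * w := by ring
      _ ≤ C ^ 2 * w * 1 := by gcongr
      _ = C ^ 2 * w := mul_one _
  calc ‖g (R (toLp 2 ![y 0, y 1, c]))‖ₑ ^ 2
      = ENNReal.ofReal (‖g (R (toLp 2 ![y 0, y 1, c]))‖ ^ 2) := by
        rw [← ofReal_norm, ENNReal.ofReal_pow (norm_nonneg _)]
    _ ≤ ENNReal.ofReal (C ^ 2 * w) := ENNReal.ofReal_le_ofReal h2

/-- **Planar ceiling from pointwise decay.** If `‖g x‖ ≤ C (1 + ‖x‖)⁻⁴` on `ℝ³`, then every planar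
energy of `g` is at most `M₀ := ∫_{ℝ²} C² (1 + ‖y‖)⁻⁴ dy` (a finite real, `M₀ ≥ 0`). -/
theorem planarEnergy_le_of_norm_le_weight {F : Type*} [NormedAddCommGroup F] {g : EuclideanSpace ℝ (Fin 3) → F} {C : ℝ}
    (h : ∀ x, ‖g x‖ ≤ C * (1 + ‖x‖) ^ (-(4 : ℝ)))
    (R : EuclideanSpace ℝ (Fin 3) ≃ₗᵢ[ℝ] EuclideanSpace ℝ (Fin 3)) (c : ℝ) :
    ∫⁻ y : EuclideanSpace ℝ (Fin 2), ‖g (R (toLp 2 ![y 0, y 1, c]))‖ₑ ^ 2 ≤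
      ENNReal.ofReal (∫ y : EuclideanSpace ℝ (Fin 2), C ^ 2 * (1 + ‖y‖) ^ (-(4 : ℝ))) := by
  calc ∫⁻ y : EuclideanSpace ℝ (Fin 2), ‖g (R (toLp 2 ![y 0, y 1, c]))‖ₑ ^ 2
      ≤ ∫⁻ y : EuclideanSpace ℝ (Fin 2), ENNReal.ofReal (C ^ 2 * (1 + ‖y‖) ^ (-(4 : ℝ))) :=
        lintegral_mono fun y => enorm_sq_comp_isometry_le h R c y
    _ = ENNReal.ofReal (∫ y : EuclideanSpace ℝ (Fin 2), C ^ 2 * (1 + ‖y‖) ^ (-(4 : ℝ))) :=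
        (ofReal_integral_eq_lintegral_ofReal (integrable_const_mul_weight_two (C ^ 2))
          (Eventually.of_forall fun y => by positivity)).symm

/-- **Stub `stub_initialPlanarCeiling` — RAPID DECAY ⇒ INITIAL PLANAR CEILING** (line `birth` of the
crux `PlanarEnergyAPriori`, registered signature verbatim). A datum with Fefferman decay (4) has
planar kinetic energy `≤ M₀` through every plane `R({x₂ = c})`, uniformly in the direction `R` and
the offset `c`: `n = 0`, `K = 4` in `HasRapidSpatialDecay` gives `|u₀(x)| ≤ C(1+|x|)⁻⁴`, isometries
preserve `1 + ‖x‖`, `‖(y₀,y₁,c)‖ ≥ ‖y‖`, and `∫_{ℝ²} C²(1+|y|)⁻⁴ dy < ∞`. [Fefferman2000, (4)] -/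
theorem stub_initialPlanarCeiling :
    ∀ (u₀ : EuclideanSpace ℝ (Fin 3) → EuclideanSpace ℝ (Fin 3)), Literature.Analysis.FluidPDE.HasRapidSpatialDecay u₀ → ∃ M₀ : ℝ, 0 ≤ M₀ ∧ ∀ (R : EuclideanSpace ℝ (Fin 3) ≃ₗᵢ[ℝ] EuclideanSpace ℝ (Fin 3)) (c : ℝ), ∫⁻ y : EuclideanSpace ℝ (Fin 2), ‖u₀ (R (WithLp.toLp 2 ![y 0, y 1, c]))‖ₑ ^ 2 ≤ ENNReal.ofReal M₀ := by
  intro u₀ hdec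
  obtain ⟨C, -, hC⟩ := norm_iteratedFDeriv_le_weight hdec 0
  have h : ∀ x, ‖u₀ x‖ ≤ C * (1 + ‖x‖) ^ (-(4 : ℝ)) := fun x => by
    simpa only [norm_iteratedFDeriv_zero] using hC x
  exact ⟨∫ y : EuclideanSpace ℝ (Fin 2), C ^ 2 * (1 + ‖y‖) ^ (-(4 : ℝ)),
    integral_nonneg fun y => by positivity, fun R c => planarEnergy_le_of_norm_le_weight h R c⟩

end Summit.NavierStokesRegularity.NavierStokesRegularity.Theorems.PlanarEnergyAPriori

end
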